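import Summits.HodgeConjecture.HodgeConjecture.Theorems.Ring2HypothesesDescentAbsoluteExteriorAction
import Literature.AlgebraicGeometry.Milne1999.SpecialLefschetzGroupInvariantsPowers
import HarnessLib

/-!
# Ring 2 — hypotheses layer, descent axis: THE GRAPH-TYPE CLASSES OF HOMOMORPHISMS `A × A → A` ARE LEFSCHETZ CLASSES ON `A³`
# (Milne 1999 Cor. 5.6 / Prop. 5.7 one power up), and van Geemen 6.5 part I for KÜNNETH FAMILIES FIXING ONLY THE LEFSCHETZ CLASSES

HONEST FRAMING (page 1, verbatim the cell's standing line): **research route conditional on HC_CM; not a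
corollary; Q11.4-sentence-2 already refuted in dim ≥ 3.** Nothing in this file proves a case of the Hodge conjecture;
nothing discharges the binder of record b06 `Ring2.Hypotheses.AbsoluteHodgeImpliesAlgebraicAV` («absolute Hodge classes
on complex abelian varieties are algebraic», `Ring2HypothesesDescent.lean` :73; OPEN); the binder table's numbers do not
move. `HC_CM` (`Theses.RankFourFaces.CMAbelianHodge`), `HC_AV`, row b06 and every hypothesis of the cell are ABSENT from this
file. Hodge ladder STAGE 3, `BINDER-OWNERS.md` row **b06**, seat `ring2-b06` (gen 85). First of two files towards the item both
gen 84 (`…ExteriorLefschetz`, honest column) and this gen's Literature file (`Milne1999/SpecialLefschetzGroupInvariantsPowers`,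
"What is NOT here") left open: **«the Tannaka-free special Lefschetz group `S(A) = Milne1999.specialLefschetzGroup` ACTS THROUGH
`H¹`»** (injectivity of `g ↦ g₁` on `S(A)`; Milne Thm. 4.4 in full on the carriers; Cor. 4.7 for the groups themselves).

THE POINT. Gen 84's dictionary (`AlgebraicStabilizerExterior.*`, van Geemen 6.5 for `G¹_alg ⊇ G¹_mot ⊇ G¹_AH ⊇ Hg`) uses its
hypothesis «the Künneth family `G` fixes every ALGEBRAIC class on every power» at exactly three kinds of classes: the unit class,
the Casimir classes `Σᵢ pr₁^* xᵢ ∪ pr₂^* xdᵢ` on `A × A` (one Künneth degree of the diagonal), and the transposed graph-type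
classes `Σᵢ pr₁^* f_p^* xᵢ ∪ pr₂^* xdᵢ` on `(A × A) × A` of the HOMOMORPHISMS `f_p = p·pr₁ + pr₂ : A × A → A`. All three are
LEFSCHETZ classes (in the `ℂ`-span of products of divisor classes): the unit trivially; the Casimir classes by Milne's Cor. 5.8
(the Milne lane's `sum_cross_self_mem_divisorClassesSpan`, `LefschetzInvolutionIsLefschetz`); and — this file, §M1 — the
graph-type classes of ANY homomorphism `F : A × A → A`, by Milne's Prop. 5.7 mechanism ONE POWER UP: the class is fixed by
`⋀•(u ⊕ u ⊕ u)` for every `u ∈ S(A)(ℂ)` (`F^*` intertwines the diagonal action, the lane's `diagPow_intertwine_right`; `⋀•u` is an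
isometry of the cup pairing, `cupPairing_exteriorPullback_exteriorPullback`; a Künneth class does not depend on the dual pair,
`PerfPairDuality.sum_dual_eq_sum_dual`), hence Lefschetz on `A³` by Cor. 4.5 there through `S(A)(ℂ)` (this gen's
`Milne1999.mem_divisorClassesSpan_powSucc_of_forall_diagPowExterior_apply_eq`). So the dictionary runs for every Künneth family
fixing only Milne's LEFSCHETZ system `lefschetzPowClasses`, i.e. for every element of `S(A)` — isometry, commutation with `F^*`,
triviality on the top degree and multiplicativity in the sequel `…ExteriorLefschetzAction`, the consequences for `S(A)` (injectivity of
`g ↦ g₁`, Thm. 4.4 in full, Cor. 4.7 Tannaka-free) in `…ExteriorLefschetzH1`.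

* §M1 `casimirClass_mem_lefschetzPowClasses` (Cor. 5.8 in the dictionary's shape: any dual pair up to a constant `c ≠ 0`),
  **`graphTypeClass_mem_lefschetzPowClasses`** (NEW: `Σᵢ pr_{A×A}^* F^* xᵢ ∪ pr_A^* xdᵢ ∈ Dⁿ_hom(A³)_ℂ` for every homomorphism
  `F : A × A → A`), `one_mem_lefschetzPowClasses_zero`.
* The sequel (`…ExteriorLefschetzAction`, namespace `SpecialLefschetzExterior`) runs gen 84's `AlgebraicStabilizerExterior` proofs
  verbatim for a Künneth family fixing only the Lefschetz classes, with the three memberships replaced by §M1.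

HONEST COLUMN. No definition, no named fact, no sorry; nothing of the cell is discharged or displayed. NOT here: graph-type classes of
homomorphisms `A^{a+1} → A` for `a ≥ 2` (same proof; not needed by the sequel). PRESEARCH: Milne 1999 Prop. 5.7 / Cor. 5.6 / Cor. 5.8 [corpus:
paper:doi-10-1215-s0012-7094-99-09620-5 pp. 663–664, as quoted in `LefschetzInvolutionIsLefschetz`]; van Geemen LNM 1594 6.4–6.5
[corpus: paper:doi-10-1007-978-3-540-49046-3-5, as quoted in `HodgeGroupExteriorAction`]; nothing in either corpus treats the
Tannaka-free (Künneth-family) form — certification by assembly, no novelty claimed. References (bib keys): Milne1999LefschetzClasses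
(§5 Prop. 5.7, Cor. 5.6, Cor. 5.8; §4 Cor. 4.5, Cor. 4.7), vanGeemen1994HodgeAV (6.4–6.5), VoisinHodgeI2002 (§11.3.3 Lemma 11.41,
(11.11)), HatcherAT2002 (§3.2 Thm. 3.16, §3.3 Prop. 3.38), Kleiman1968AlgebraicCycles (§2 App. 2A), Deligne1982HodgeCycles (I §3).
-/

noncomputable section

-- every declaration of this problem lives in `Summit.HodgeConjecture.HodgeConjecture.…` (summit = sub-problem)
set_option linter.dupNamespace false

namespace Summit.HodgeConjecture.HodgeConjecture.Ring2.Hypotheses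

open CategoryTheory AlgebraicGeometry MonoidalCategory CartesianMonoidalCategory
open Literature.AlgebraicGeometry Literature.AlgebraicGeometry.Motives
open Literature.AlgebraicGeometry.HodgeTheory
open Literature.AlgebraicTopology.SingularHomology
open Literature.Barriers.HodgeConjecture (divisorClassesSpan)
open Literature.AlgebraicGeometry.Milne1999 (specialLefschetzGroup lefschetzPowClasses unitaryCentralizerGroup diagPow
  diagPowExterior prodBlockDiagEquiv exteriorPullbackEquiv)

/-! ## §M1 The Lefschetz graph-type classes: unit, Casimir classes on `A × A`, graphs of homomorphisms `A × A → A` on `A³` -/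

section GraphClasses

variable (A : AbelianVariety ℂ)

/-- `1 ∈ H⁰(A(ℂ); ℂ)` lies in the Lefschetz system of the first power (`D⁰ = ℂ · 1`, the empty divisor monomial). [folklore] -/
theorem one_mem_lefschetzPowClasses_zero :
    (singularCohomology.one ℂ (ComplexPoints A.X) : complexBetti (cartesianPow A.X 1) (2 * 0)) ∈ lefschetzPowClasses A.dim A.X 0 0 :=
  Milne1999.mem_divisorClassesSpan_of_eq_zero_or_lt A (Or.inl rfl) _

/-- **The Casimir classes of `A × A` are Lefschetz** (Milne Cor. 5.8 «the Künneth components of the diagonal are Lefschetz», the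
Milne lane's `sum_cross_self_mem_divisorClassesSpan`, in the shape of gen 84's dictionary): for a basis `x` of `Hᵏ(A(ℂ); ℂ)` and `xd`
with `⟨x_i ∪ xd_j, [A(ℂ)]⟩ = c δ_{ij}`, `c ≠ 0`, the class `Σ_i pr₁^* x_i ∪ pr₂^* xd_i ∈ H^{2n}((A × A)(ℂ); ℂ)` (`n = dim A`) lies in
`lefschetzPowClasses (dim A) A.X 1 n = Dⁿ_hom(A^{×2})_ℂ` (rescale `xd` by `c⁻¹`; `A × A = A.X^{×2}` on the nose, `dim (A × A) = 2 dim A`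
by `AbelianVariety.dim_prod`). [cite: Milne1999LefschetzClasses, Cor. 5.8 and Prop. 5.7 (p. 664)] [cite: VoisinHodgeI2002, §11.3.3 (11.11)] -/
theorem casimirClass_mem_lefschetzPowClasses {k d : ℕ} (hkd : k + d = 2 * A.dim) {ι : Type} [Fintype ι] [DecidableEq ι]
    (x : Module.Basis ι ℂ (complexBetti A.X k)) {xd : ι → complexBetti A.X d} {c : ℂ} (hc : c ≠ 0)
    (hd : ∀ i j, cupPairing (complexOrientationFamily (AbelianVariety.isSmoothProjective_holds (A := A))) hkd (x i) (xd j) =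
      if i = j then c else 0) :
    (∑ i, cupProduct hkd (complexBetti.map (fst A.X A.X) k (x i)) (complexBetti.map (snd A.X A.X) d (xd i))) ∈
      lefschetzPowClasses A.dim A.X 1 A.dim := by
  have key : (∑ i, cupProduct hkd (complexBetti.map (fst A.X A.X) k (x i)) (complexBetti.map (snd A.X A.X) d (xd i)) :
      complexBetti (A.X ⊗ A.X) (2 * A.dim)) ∈ divisorClassesSpan (A.prod A).X (A.prod A).dim A.dim := by
    rcases Nat.eq_zero_or_pos A.dim with hA | hA0
    · exact Milne1999.mem_divisorClassesSpan_of_eq_zero_or_lt (A.prod A) (Or.inl hA) _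
    · -- normalise the dual family to `c = 1` and rescale
      have hd' : ∀ i j, cupPairing (complexOrientationFamily (AbelianVariety.isSmoothProjective_holds (A := A))) hkd (x i)
          (c⁻¹ • xd j) = if i = j then 1 else 0 := by
        intro i j
        rw [map_smul, hd, smul_eq_mul]
        split_ifs
        · exact inv_mul_cancel₀ hc
        · exact mul_zero _
      have h := Milne1999.sum_cross_self_mem_divisorClassesSpan A hA0 hkd complexOrientationFamily x hd'
      have hsmul : (∑ i, cupProduct hkd (complexBetti.map (fst A.X A.X) k (x i)) (complexBetti.map (snd A.X A.X) d (xd i)) :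
          complexBetti (A.X ⊗ A.X) (2 * A.dim)) =
          c • ∑ i, cupProduct hkd (complexBetti.map (fst A.X A.X) k (x i)) (complexBetti.map (snd A.X A.X) d (c⁻¹ • xd i)) := by
        rw [Finset.smul_sum]
        refine Finset.sum_congr rfl fun i _ ↦ ?_
        rw [map_smul, map_smul, smul_smul, mul_inv_cancel₀ hc, one_smul]
      rw [hsmul]
      exact Submodule.smul_mem _ _ h
  rw [AbelianVariety.dim_prod] at key
  exact key

variable {A} in
/-- **The diagonal action on a sum of cross products, two factors `B × C`**: `⋀ⁿ(s ⊕ t) (Σⱼ pr_B^* vⱼ ∪ pr_C^* wⱼ) =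
Σⱼ pr_B^*(⋀ᵏs vⱼ) ∪ pr_C^*(⋀ᵈt wⱼ)` (the lane's `exteriorPullback_prodBlockDiagEquiv_cross`, summed).
[cite: Milne1999LefschetzClasses, §5 p. 664 and §1 p. 643] [cite: HatcherAT2002, §3.2 Thm. 3.16] -/
theorem exteriorPullback_prodBlockDiagEquiv_sum_cross {B C : AbelianVariety ℂ} (s : complexBetti B.X 1 ≃ₗ[ℂ] complexBetti B.X 1)
    (t : complexBetti C.X 1 ≃ₗ[ℂ] complexBetti C.X 1) {k d n : ℕ} (hkd : k + d = n) {ι : Type} [Fintype ι]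
    (v : ι → complexBetti B.X k) (w : ι → complexBetti C.X d) :
    exteriorPullback (AbelianVariety.hasExteriorCohomologyH1_complexPoints (B.prod C)) (prodBlockDiagEquiv s t).toLinearMap n
        (∑ j, cupProduct hkd (complexBetti.map (AbelianVariety.fst B C).hom.hom.hom k (v j))
          (complexBetti.map (AbelianVariety.snd B C).hom.hom.hom d (w j))) =
      ∑ j, cupProduct hkd
        (complexBetti.map (AbelianVariety.fst B C).hom.hom.hom k
          (exteriorPullback (AbelianVariety.hasExteriorCohomologyH1_complexPoints B) s.toLinearMap k (v j)))
        (complexBetti.map (AbelianVariety.snd B C).hom.hom.hom d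
          (exteriorPullback (AbelianVariety.hasExteriorCohomologyH1_complexPoints C) t.toLinearMap d (w j))) := by
  rw [map_sum]
  exact Finset.sum_congr rfl fun j _ ↦ Milne1999.exteriorPullback_prodBlockDiagEquiv_cross s t hkd (v j) (w j)

variable {A} in
/-- **Pull-back along a homomorphism `F : A² → A` intertwines the diagonal actions on all of `H•`**: for `u` commuting with
`End(A)` on `H¹(A)`, `⋀ᵏ(u ⊕ u) ∘ F^* = F^* ∘ ⋀ᵏu` on `Hᵏ(A(ℂ); ℂ)` — on `H¹` this is the lane's `diagPow_intertwine_right`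
(Milne §1 p. 643), and both sides are multiplicative on the monomials `v₁ ∪ ⋯ ∪ v_k` that span `Hᵏ = ⋀ᵏH¹`
(`complexBetti_map_cupPowOne`, `exteriorPullback_cupPowOne`). [cite: Milne1999LefschetzClasses, §1 p. 643 and Cor. 5.6 (p. 663)]
[cite: HatcherAT2002, §3.2 Example 3.16] -/
theorem exteriorPullback_diagPow_one_map (F : A.powSucc 1 ⟶ A) {u : complexBetti A.X 1 ≃ₗ[ℂ] complexBetti A.X 1}
    (hu : u ∈ Milne1999.centralizerGroup A) (k : ℕ) (y : complexBetti A.X k) :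
    exteriorPullback (AbelianVariety.hasExteriorCohomologyH1_complexPoints (A.powSucc 1)) (diagPow A u 1).toLinearMap k
        (complexBetti.map F.hom.hom.hom k y) =
      complexBetti.map F.hom.hom.hom k
        (exteriorPullback (AbelianVariety.hasExteriorCohomologyH1_complexPoints A) u.toLinearMap k y) := by
  have hΛ := AbelianVariety.hasExteriorCohomologyH1_complexPoints A
  have hΛ2 := AbelianVariety.hasExteriorCohomologyH1_complexPoints (A.powSucc 1)
  have key : (exteriorPullback hΛ2 (diagPow A u 1).toLinearMap k) ∘ₗ (complexBetti.map F.hom.hom.hom k).hom =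
      (complexBetti.map F.hom.hom.hom k).hom ∘ₗ exteriorPullback hΛ u.toLinearMap k := by
    refine exteriorPullback_ext hΛ fun v ↦ ?_
    change exteriorPullback hΛ2 (diagPow A u 1).toLinearMap k (complexBetti.map F.hom.hom.hom k (cupPowOne ℂ (ComplexPoints A.X) k v)) =
      complexBetti.map F.hom.hom.hom k (exteriorPullback hΛ u.toLinearMap k (cupPowOne ℂ (ComplexPoints A.X) k v))
    rw [complexBetti_map_cupPowOne, exteriorPullback_cupPowOne, exteriorPullback_cupPowOne, complexBetti_map_cupPowOne]
    congr 1
    funext j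
    exact Milne1999.diagPow_intertwine_right hu (a := 1) F (v j)
  exact LinearMap.congr_fun key y

/-- **THE TRANSPOSED GRAPH-TYPE CLASS OF A HOMOMORPHISM `F : A² → A` IS A LEFSCHETZ CLASS ON `A³`, ONE DEGREE AT A TIME** (Milne
Cor. 5.6 «the graph of any regular map of abelian varieties is Lefschetz» with Prop. 5.7, for the correspondence `F` between `A²` and
`A`, on the tree's carriers): for a morphism `f : A.X^{×2} ⟶ A.X` underlying a homomorphism `F : A² → A`, a basis `x` of `Hᵏ(A(ℂ); ℂ)`
and `xd` with `⟨x_i ∪ xd_j, [A]⟩ = c δ_{ij}`, `c ≠ 0`, the class `Σ_i pr_{A^{×2}}^* f^* x_i ∪ pr_A^* xd_i ∈ H^{2n}(A.X^{×3}(ℂ); ℂ)`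
lies in `lefschetzPowClasses (dim A) A.X 2 n = Dⁿ_hom(A^{×3})_ℂ`. Proof (`n ≥ 1`; `h` the rational Kähler class of a projective
embedding, `S(A)(ℂ) = unitaryCentralizerGroup A h`): after normalising `c = 1`, the class is fixed by `⋀•(u ⊕ u ⊕ u)` for every
`u ∈ S(A)(ℂ)` — `⋀(u⊕u⊕u)(pr^* X ∪ pr^* Y) = pr^*(⋀(u⊕u) X) ∪ pr^*(⋀u Y)` (`exteriorPullback_prodBlockDiagEquiv_sum_cross`),
`⋀(u⊕u) F^* x_i = F^* ⋀u x_i` (previous theorem), and `(⋀u x_i, ⋀u xd_i)` is again a dual pair (`det u = 1`,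
`cupPairing_exteriorPullback_exteriorPullback`) giving the same class (`PerfPairDuality.sum_dual_eq_sum_dual`) — hence Lefschetz on
`A³ = A.powSucc 2` by Cor. 4.5 there through `S(A)(ℂ)` (`Milne1999.mem_divisorClassesSpan_powSucc_of_forall_diagPowExterior_apply_eq`;
`A.powSucc 2 = A.X^{×3}` on the nose and `dim = cartesianPowDim (dim A) 2`).
[cite: Milne1999LefschetzClasses, Cor. 5.6 (p. 663), Prop. 5.7 (p. 664), Cor. 4.5 and Cor. 4.7 (p. 659)]
[cite: VoisinHodgeI2002, §11.3.3 Lemma 11.41 with (11.11)] -/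
theorem graphTypeClass_mem_lefschetzPowClasses (f : cartesianPow A.X (1 + 1) ⟶ A.X) (hf : ∃ F : A.powSucc 1 ⟶ A, F.hom.hom.hom = f)
    {k d : ℕ} (hkd : k + d = 2 * A.dim) {ι : Type} [Fintype ι] [DecidableEq ι] (x : Module.Basis ι ℂ (complexBetti A.X k))
    {xd : ι → complexBetti A.X d} {c : ℂ} (hc : c ≠ 0)
    (hd : ∀ i j, cupPairing (complexOrientationFamily (AbelianVariety.isSmoothProjective_holds (A := A))) hkd (x i) (xd j) =
      if i = j then c else 0) :
    (∑ i, cupProduct hkd (complexBetti.map (fst (cartesianPow A.X (1 + 1)) A.X) k (complexBetti.map f k (x i)))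
        (complexBetti.map (snd (cartesianPow A.X (1 + 1)) A.X) d (xd i))) ∈ lefschetzPowClasses A.dim A.X 2 A.dim := by
  classical
  obtain ⟨F, rfl⟩ := hf
  have hX : IsSmoothProjective A.dim A.X := AbelianVariety.isSmoothProjective_holds (A := A)
  have hΛ := AbelianVariety.hasExteriorCohomologyH1_complexPoints A
  -- the class on the abelian variety `A³ = A.powSucc 2 = A² × A`, written with its projections (same carrier, on the nose)
  have key : (∑ i, cupProduct hkd
      (complexBetti.map (AbelianVariety.fst (A.powSucc 1) A).hom.hom.hom k (complexBetti.map F.hom.hom.hom k (x i)))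
      (complexBetti.map (AbelianVariety.snd (A.powSucc 1) A).hom.hom.hom d (xd i))) ∈
      divisorClassesSpan (A.powSucc 2).X (A.powSucc 2).dim A.dim := by
    rcases Nat.eq_zero_or_pos A.dim with hA | hA0
    · exact Milne1999.mem_divisorClassesSpan_of_eq_zero_or_lt (A.powSucc 2) (Or.inl hA) _
    -- polarize `A` by the rational Kähler class of a projective embedding
    obtain ⟨D⟩ := nonempty_kaehlerRationalDatum hX
    have hK1 : IsKaehlerClass A.dim A.X (((1 : ℝ) : ℂ) • D.Hη) := by
      rw [Complex.ofReal_one, one_smul]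
      exact D.isKaehlerClassVia.isKaehlerClass D.isNatural D.isMultiplicative
    have hK : ∃ s : ℝ, 0 < s ∧ IsKaehlerClass A.dim A.X ((s : ℂ) • D.Hη) := ⟨1, one_pos, hK1⟩
    have hnd := Milne1999.eq_zero_of_forall_polarizationPairingOne_eq_zero_of_isKaehlerClass_smul' one_ne_zero hK1
    have hh := Milne1999.mem_hodgeClassSpan_one_of_isKaehlerClass_smul D.isRationalClass_Hη one_ne_zero hK1
    have htop := Milne1999.lefschetzPow_self_ne_zero_of_isKaehlerClass_smul hA0 hK1
    -- normalise the dual family to `c = 1`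
    have hd' : ∀ i j, cupPairing (complexOrientationFamily hX) hkd (x i) (c⁻¹ • xd j) = if i = j then 1 else 0 := by
      intro i j
      rw [map_smul, hd, smul_eq_mul]
      split_ifs
      · exact inv_mul_cancel₀ hc
      · exact mul_zero _
    -- the Künneth-class bilinear map `Φ(v, w) = pr^* F^* v ∪ pr^* w` on `A² × A`
    let Φ : complexBetti A.X k →ₗ[ℂ] complexBetti A.X d →ₗ[ℂ] complexBetti ((A.powSucc 1).prod A).X (2 * A.dim) :=
      ((cupProduct hkd) ∘ₗ ((complexBetti.map (AbelianVariety.fst (A.powSucc 1) A).hom.hom.hom k).hom ∘ₗ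
        (complexBetti.map F.hom.hom.hom k).hom)).compl₂ (complexBetti.map (AbelianVariety.snd (A.powSucc 1) A).hom.hom.hom d).hom
    have hΦ : ∀ v w, Φ v w = cupProduct hkd
        (complexBetti.map (AbelianVariety.fst (A.powSucc 1) A).hom.hom.hom k (complexBetti.map F.hom.hom.hom k v))
        (complexBetti.map (AbelianVariety.snd (A.powSucc 1) A).hom.hom.hom d w) := fun v w ↦ rfl
    have hsmul : (∑ i, cupProduct hkd
        (complexBetti.map (AbelianVariety.fst (A.powSucc 1) A).hom.hom.hom k (complexBetti.map F.hom.hom.hom k (x i)))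
        (complexBetti.map (AbelianVariety.snd (A.powSucc 1) A).hom.hom.hom d (xd i))) = c • ∑ i, Φ (x i) (c⁻¹ • xd i) := by
      rw [Finset.smul_sum]
      refine Finset.sum_congr rfl fun i _ ↦ ?_
      rw [map_smul, smul_inv_smul₀ hc, hΦ]
    rw [hsmul]
    refine Submodule.smul_mem _ _ ?_
    refine Milne1999.mem_divisorClassesSpan_powSucc_of_forall_diagPowExterior_apply_eq hA0 hh htop hnd 2 A.dim _ fun u hu ↦ ?_
    have hdet : LinearMap.det (u : complexBetti A.X 1 →ₗ[ℂ] complexBetti A.X 1) = 1 :=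
      Milne1999.det_eq_one_of_mem_unitaryCentralizerGroup D.isRationalClass_Hη hK hu
    -- the moved dual pair `(⋀ᵏu xᵢ, ⋀ᵈu (c⁻¹ xdᵢ))`
    let y' : Module.Basis ι ℂ (complexBetti A.X k) := x.map (exteriorPullbackEquiv hΛ u k)
    have hy' : ∀ j, y' j = exteriorPullback hΛ (u : complexBetti A.X 1 →ₗ[ℂ] complexBetti A.X 1) k (x j) :=
      fun j ↦ by rw [Module.Basis.map_apply, Milne1999.exteriorPullbackEquiv_apply]
    have hyd' : ∀ i j, cupPairing (complexOrientationFamily hX) hkd (y' i)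
        (exteriorPullback hΛ (u : complexBetti A.X 1 →ₗ[ℂ] complexBetti A.X 1) d (c⁻¹ • xd j)) = if i = j then 1 else 0 := by
      intro i j
      rw [hy', Milne1999.cupPairing_exteriorPullback_exteriorPullback (complexOrientationFamily hX) u hdet hkd, hd']
    have hdual := PerfPairDuality.sum_dual_eq_sum_dual (isPerfPair_cupPairing_complexPoints complexOrientationFamily hX hkd)
      x hd' y' hyd' Φ
    -- `⋀(u ⊕ u ⊕ u) = ⋀((u ⊕ u) ⊕ u)` on the sum (the carriers of `A.powSucc 2` and `A² × A` agree on the nose; no `rw` across them)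
    have h1 := exteriorPullback_prodBlockDiagEquiv_sum_cross (diagPow A u 1) u hkd
      (fun i ↦ complexBetti.map F.hom.hom.hom k (x i)) (fun i ↦ c⁻¹ • xd i)
    have h3 : (∑ i, cupProduct hkd
        (complexBetti.map (AbelianVariety.fst (A.powSucc 1) A).hom.hom.hom k
          (exteriorPullback (AbelianVariety.hasExteriorCohomologyH1_complexPoints (A.powSucc 1)) (diagPow A u 1).toLinearMap k
            (complexBetti.map F.hom.hom.hom k (x i))))
        (complexBetti.map (AbelianVariety.snd (A.powSucc 1) A).hom.hom.hom d
          (exteriorPullback hΛ (u : complexBetti A.X 1 →ₗ[ℂ] complexBetti A.X 1) d (c⁻¹ • xd i)))) =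
        ∑ i, Φ (y' i) (exteriorPullback hΛ (u : complexBetti A.X 1 →ₗ[ℂ] complexBetti A.X 1) d (c⁻¹ • xd i)) := by
      refine Finset.sum_congr rfl fun i _ ↦ ?_
      rw [hΦ, hy', exteriorPullback_diagPow_one_map F hu.1 k (x i)]
    have h4 : (∑ i, Φ (x i) (c⁻¹ • xd i)) = ∑ i, cupProduct hkd
        (complexBetti.map (AbelianVariety.fst (A.powSucc 1) A).hom.hom.hom k (complexBetti.map F.hom.hom.hom k (x i)))
        (complexBetti.map (AbelianVariety.snd (A.powSucc 1) A).hom.hom.hom d (c⁻¹ • xd i)) :=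
      Finset.sum_congr rfl fun i _ ↦ hΦ _ _
    rw [h4]
    exact h1.trans (h3.trans (hdual.symm.trans h4))
  rw [A.dim_powSucc_eq_cartesianPowDim 2] at key
  exact key

end GraphClasses


end Summit.HodgeConjecture.HodgeConjecture.Ring2.Hypotheses

end
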